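import Mathlib.Tactic.Ring
import Mathlib.Tactic.NormNum
import Summits.CriticalPhenomena.PercolationContinuityZ3.Theorems.PercNearOneGluingNoHeavyLowerTailSahiCTCVertexAtoms
import HarnessLib

/-!
# `NoHeavyLowerTail` (crux stmt-CriticalPhenomena-4575), P3 lane: the form `G(0,1,1)` relative to a ground finset and its VERTEX EXPANSION
# `G011_V = G011_{V−v} + r_v·N₁ + r_v²·N₂ + r_v³·N₃`

Support file (seat `prim-l12-p3`, gen 19; `--supports stmt-CriticalPhenomena-4575`).  Memo `run/shared/lean/prim/prim-l12/FROM-prim-l12-p3-g19-CERTIFICATE-ROAD-G011.md`;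
memo g9 (`…-g9-COEFFICIENTWISE-THRESHOLD-CERTIFICATE.md`) §7 for the inductive certificate framework.  Nothing is asserted about the crux.

g9 §4.3/§8.2: `G(0,1,1)(P,Q) = (Π+D₁)(Π·h_Y − h_P·h_Q) − Π·D₁·e_Y − D₁·(h_P·t_Q + t_P·h_Q) + Θ₁·t_P·t_Q` with `h` = faces of size `≤ 1`, `t` = faces of size
`≥ 2`, `h_Y`/`e_Y` = common faces of size `≤ 1` / `= 1`, `D₁ = e_{≥2}`, `Θ₁ = e_{≤1}` — the 'G011' hypothesis of the c = 2 step certificates (G022-ll N₃, G111,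
TRI₂, BIS₂, …) and the first form closed by the certificate road (`…SahiCTCG011`).  Here: the objects relative to `V` (`PiV, Th1V, D1V, D0V, hV, tV, hYV,
eYV` and the link objects `h0L, t0L, hY0L`), the form `G011V`, the generated object-form coefficients `G011N1/2/3` of its vertex expansion and the expansion
identity `G011V_expand` (by the vertex split + `ring`), the symmetry `G011V_comm` and the base case `G011V_empty`.
-/

namespace Summit.CriticalPhenomena.PercolationContinuityZ3.Theorems.SahiCTCForms

open Finset MvPolynomial SahiCTCGenFun SahiCTCWeightedLYM

variable {α : Type*} [DecidableEq α]

/-! ### Ground-set relative objects at threshold level c = 1 and the form `G(0,1,1)` (g9 §4.3 / §8.2) -/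

section objects
variable (V : Finset α) (K KX KZ : Finset (Finset α)) (v : α)

/-- `Π_V = GF(2^V)`. [this work] -/
noncomputable def PiV : MvPolynomial α ℤ := gf V.powerset
/-- `Θ₁^V` = sets of size `≤ 1` in `V`. [this work] -/
noncomputable def Th1V : MvPolynomial α ℤ := gf (V.powerset.filter fun S => #S ≤ 1)
/-- `D₁^V = e^V_{≥2}` = sets of size `≥ 2` in `V`. [this work] -/
noncomputable def D1V : MvPolynomial α ℤ := gf (V.powerset.filter fun S => 2 ≤ #S)
/-- `D₀^V = e^V_{≥1}` = nonempty sets in `V` (the link of `D₁`). [this work] -/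
noncomputable def D0V : MvPolynomial α ℤ := gf (V.powerset.filter fun S => 1 ≤ #S)
/-- `h_K` = faces of `K` of size `≤ 1` inside `V`. [this work] -/
noncomputable def hV : MvPolynomial α ℤ := gf (V.powerset.filter fun S => #S ≤ 1 ∧ S ∈ K)
/-- `t_K` = faces of `K` of size `≥ 2` inside `V`. [this work] -/
noncomputable def tV : MvPolynomial α ℤ := gf (V.powerset.filter fun S => 2 ≤ #S ∧ S ∈ K)
/-- `h_Y` = common faces of size `≤ 1`. [this work] -/
noncomputable def hYV : MvPolynomial α ℤ := gf (V.powerset.filter fun S => #S ≤ 1 ∧ S ∈ KX ∧ S ∈ KZ)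
/-- `e_Y` = common vertices (common faces of size exactly `1`). [this work] -/
noncomputable def eYV : MvPolynomial α ℤ := gf (V.powerset.filter fun S => #S = 1 ∧ S ∈ KX ∧ S ∈ KZ)
/-- link of `h_K` at `v`: `[{v} ∈ K]` as the family `{∅}` or `∅`. [this work] -/
noncomputable def h0L : MvPolynomial α ℤ := gf (V.powerset.filter fun S => #S = 0 ∧ insert v S ∈ K)
/-- link of `t_K` at `v`: nonempty `S ⊆ V` with `S ∪ {v} ∈ K`. [this work] -/
noncomputable def t0L : MvPolynomial α ℤ := gf (V.powerset.filter fun S => 1 ≤ #S ∧ insert v S ∈ K)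
/-- link of `h_Y` (and of `e_Y`) at `v`: `[{v} ∈ KX ∩ KZ]`. [this work] -/
noncomputable def hY0L : MvPolynomial α ℤ := gf (V.powerset.filter fun S => #S = 0 ∧ insert v S ∈ KX ∧ insert v S ∈ KZ)

/-- **The form `G(0,1,1)` relative to the ground finset `V`** (g9 §4.3 with `(a,b,ℓ) = (0,1,1)`, §8.2):
`(Π+D₁)(Π·h_Y − h_X·h_Z) − Π·D₁·e_Y − D₁·(h_X·t_Z + t_X·h_Z) + Θ₁·t_X·t_Z`. [this work] -/
noncomputable def G011V : MvPolynomial α ℤ :=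
  (PiV V + D1V V) * (PiV V * hYV V KX KZ - hV V KX * hV V KZ) - PiV V * D1V V * eYV V KX KZ
    - D1V V * (hV V KX * tV V KZ + tV V KX * hV V KZ) + Th1V V * tV V KX * tV V KZ

/-- The coefficient of `r_v^1` in the vertex expansion of `G(0,1,1)` (object form, generated). [this work] -/
noncomputable def G011N1 (V : Finset α) (KX KZ : Finset (Finset α)) (v : α) : MvPolynomial α ℤ :=
  Th1V (V.erase v) * tV (V.erase v) KX * t0L (V.erase v) KZ v
    + Th1V (V.erase v) * t0L (V.erase v) KX v * tV (V.erase v) KZ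
    + D1V (V.erase v) * PiV (V.erase v) * hYV (V.erase v) KX KZ
    + D1V (V.erase v) * PiV (V.erase v) * hY0L (V.erase v) KX KZ v
    - D1V (V.erase v) * PiV (V.erase v) * eYV (V.erase v) KX KZ
    - D1V (V.erase v) * PiV (V.erase v) * hY0L (V.erase v) KX KZ v
    - D1V (V.erase v) * hV (V.erase v) KX * h0L (V.erase v) KZ v
    - D1V (V.erase v) * hV (V.erase v) KX * t0L (V.erase v) KZ v
    - D1V (V.erase v) * h0L (V.erase v) KX v * hV (V.erase v) KZ
    - D1V (V.erase v) * h0L (V.erase v) KX v * tV (V.erase v) KZ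
    - D1V (V.erase v) * tV (V.erase v) KX * h0L (V.erase v) KZ v
    - D1V (V.erase v) * t0L (V.erase v) KX v * hV (V.erase v) KZ
    + D0V (V.erase v) * PiV (V.erase v) * hYV (V.erase v) KX KZ
    - D0V (V.erase v) * PiV (V.erase v) * eYV (V.erase v) KX KZ
    - D0V (V.erase v) * hV (V.erase v) KX * hV (V.erase v) KZ
    - D0V (V.erase v) * hV (V.erase v) KX * tV (V.erase v) KZ
    - D0V (V.erase v) * tV (V.erase v) KX * hV (V.erase v) KZ
    + (2 : MvPolynomial α ℤ) * PiV (V.erase v) * PiV (V.erase v) * hYV (V.erase v) KX KZ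
    + PiV (V.erase v) * PiV (V.erase v) * hY0L (V.erase v) KX KZ v
    - PiV (V.erase v) * hV (V.erase v) KX * hV (V.erase v) KZ
    - PiV (V.erase v) * hV (V.erase v) KX * h0L (V.erase v) KZ v
    - PiV (V.erase v) * h0L (V.erase v) KX v * hV (V.erase v) KZ
    + tV (V.erase v) KX * tV (V.erase v) KZ

/-- The coefficient of `r_v^2` in the vertex expansion of `G(0,1,1)` (object form, generated). [this work] -/
noncomputable def G011N2 (V : Finset α) (KX KZ : Finset (Finset α)) (v : α) : MvPolynomial α ℤ :=
  Th1V (V.erase v) * t0L (V.erase v) KX v * t0L (V.erase v) KZ v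
    + D1V (V.erase v) * PiV (V.erase v) * hY0L (V.erase v) KX KZ v
    - D1V (V.erase v) * PiV (V.erase v) * hY0L (V.erase v) KX KZ v
    - D1V (V.erase v) * h0L (V.erase v) KX v * h0L (V.erase v) KZ v
    - D1V (V.erase v) * h0L (V.erase v) KX v * t0L (V.erase v) KZ v
    - D1V (V.erase v) * t0L (V.erase v) KX v * h0L (V.erase v) KZ v
    + D0V (V.erase v) * PiV (V.erase v) * hYV (V.erase v) KX KZ
    + D0V (V.erase v) * PiV (V.erase v) * hY0L (V.erase v) KX KZ v
    - D0V (V.erase v) * PiV (V.erase v) * eYV (V.erase v) KX KZ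
    - D0V (V.erase v) * PiV (V.erase v) * hY0L (V.erase v) KX KZ v
    - D0V (V.erase v) * hV (V.erase v) KX * h0L (V.erase v) KZ v
    - D0V (V.erase v) * hV (V.erase v) KX * t0L (V.erase v) KZ v
    - D0V (V.erase v) * h0L (V.erase v) KX v * hV (V.erase v) KZ
    - D0V (V.erase v) * h0L (V.erase v) KX v * tV (V.erase v) KZ
    - D0V (V.erase v) * tV (V.erase v) KX * h0L (V.erase v) KZ v
    - D0V (V.erase v) * t0L (V.erase v) KX v * hV (V.erase v) KZ
    + PiV (V.erase v) * PiV (V.erase v) * hYV (V.erase v) KX KZ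
    + (2 : MvPolynomial α ℤ) * PiV (V.erase v) * PiV (V.erase v) * hY0L (V.erase v) KX KZ v
    - PiV (V.erase v) * hV (V.erase v) KX * h0L (V.erase v) KZ v
    - PiV (V.erase v) * h0L (V.erase v) KX v * hV (V.erase v) KZ
    - PiV (V.erase v) * h0L (V.erase v) KX v * h0L (V.erase v) KZ v
    + tV (V.erase v) KX * t0L (V.erase v) KZ v
    + t0L (V.erase v) KX v * tV (V.erase v) KZ

/-- The coefficient of `r_v^3` in the vertex expansion of `G(0,1,1)` (object form, generated). [this work] -/
noncomputable def G011N3 (V : Finset α) (KX KZ : Finset (Finset α)) (v : α) : MvPolynomial α ℤ :=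
  D0V (V.erase v) * PiV (V.erase v) * hY0L (V.erase v) KX KZ v
    - D0V (V.erase v) * PiV (V.erase v) * hY0L (V.erase v) KX KZ v
    - D0V (V.erase v) * h0L (V.erase v) KX v * h0L (V.erase v) KZ v
    - D0V (V.erase v) * h0L (V.erase v) KX v * t0L (V.erase v) KZ v
    - D0V (V.erase v) * t0L (V.erase v) KX v * h0L (V.erase v) KZ v
    + PiV (V.erase v) * PiV (V.erase v) * hY0L (V.erase v) KX KZ v
    - PiV (V.erase v) * h0L (V.erase v) KX v * h0L (V.erase v) KZ v
    + t0L (V.erase v) KX v * t0L (V.erase v) KZ v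


end objects

/-! ### The vertex expansion of `G(0,1,1)` -/

section expansion
variable {V : Finset α} {v : α} (K KX KZ : Finset (Finset α))

/-- link normalisations: `#(S ∪ {v})` conditions for `v ∉ S`. [this work] -/
theorem link_filter_congr (V : Finset α) (v : α) {p q : Finset α → Prop} [DecidablePred p] [DecidablePred q]
    (h : ∀ S, v ∉ S → (p S ↔ q S)) : (V.erase v).powerset.filter p = (V.erase v).powerset.filter q := by
  refine filter_congr fun S hS => h S ?_
  exact (subset_erase.1 (mem_powerset.1 hS)).2

/-- **Vertex expansion** `G011_V = G011_{V−v} + r_v·N₁ + r_v²·N₂ + r_v³·N₃`. [this work] -/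
theorem G011V_expand (hv : v ∈ V) :
    G011V V KX KZ = G011V (V.erase v) KX KZ + X v * G011N1 V KX KZ v + X v ^ 2 * G011N2 V KX KZ v + X v ^ 3 * G011N3 V KX KZ v := by
  have l1 : ((V.erase v).powerset.filter fun S => 2 ≤ #(insert v S)) = (V.erase v).powerset.filter fun S => 1 ≤ #S :=
    link_filter_congr V v fun S hS => by rw [card_insert_of_notMem hS]; exact ⟨fun h => by omega, fun h => by omega⟩
  have l2 : ((V.erase v).powerset.filter fun S => #(insert v S) ≤ 1) = (V.erase v).powerset.filter fun S => #S = 0 :=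
    link_filter_congr V v fun S hS => by rw [card_insert_of_notMem hS]; exact ⟨fun h => by omega, fun h => by omega⟩
  have l3 : ∀ K : Finset (Finset α), ((V.erase v).powerset.filter fun S => #(insert v S) ≤ 1 ∧ insert v S ∈ K) =
      (V.erase v).powerset.filter fun S => #S = 0 ∧ insert v S ∈ K := fun K =>
    link_filter_congr V v fun S hS => by rw [card_insert_of_notMem hS]; exact and_congr ⟨fun h => by omega, fun h => by omega⟩ Iff.rfl
  have l4 : ∀ K : Finset (Finset α), ((V.erase v).powerset.filter fun S => 2 ≤ #(insert v S) ∧ insert v S ∈ K) =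
      (V.erase v).powerset.filter fun S => 1 ≤ #S ∧ insert v S ∈ K := fun K =>
    link_filter_congr V v fun S hS => by rw [card_insert_of_notMem hS]; exact and_congr ⟨fun h => by omega, fun h => by omega⟩ Iff.rfl
  have l5 : ((V.erase v).powerset.filter fun S => #(insert v S) ≤ 1 ∧ insert v S ∈ KX ∧ insert v S ∈ KZ) =
      (V.erase v).powerset.filter fun S => #S = 0 ∧ insert v S ∈ KX ∧ insert v S ∈ KZ :=
    link_filter_congr V v fun S hS => by rw [card_insert_of_notMem hS]; exact and_congr ⟨fun h => by omega, fun h => by omega⟩ Iff.rfl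
  have l6 : ((V.erase v).powerset.filter fun S => #(insert v S) = 1 ∧ insert v S ∈ KX ∧ insert v S ∈ KZ) =
      (V.erase v).powerset.filter fun S => #S = 0 ∧ insert v S ∈ KX ∧ insert v S ∈ KZ :=
    link_filter_congr V v fun S hS => by rw [card_insert_of_notMem hS]; exact and_congr ⟨fun h => by omega, fun h => by omega⟩ Iff.rfl
  have l7 : gf ((V.erase v).powerset.filter fun S => #S = 0) = (1 : MvPolynomial α ℤ) := by
    have : ((V.erase v).powerset.filter fun S => #S = 0) = {∅} := by
      ext S; simp only [mem_filter, mem_powerset, card_eq_zero, mem_singleton]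
      exact ⟨fun h => h.2, fun h => ⟨h ▸ empty_subset _, h⟩⟩
    rw [this]; unfold gf; rw [sum_singleton]; unfold ind; rw [sum_empty]; rfl
  unfold G011V G011N1 G011N2 G011N3 PiV Th1V D1V D0V hV tV hYV eYV h0L t0L hY0L
  rw [gf_powerset_split hv, gf_powerset_filter_split hv (fun S => #S ≤ 1), gf_powerset_filter_split hv (fun S => 2 ≤ #S),
    gf_powerset_filter_split hv (fun S => #S ≤ 1 ∧ S ∈ KX), gf_powerset_filter_split hv (fun S => #S ≤ 1 ∧ S ∈ KZ),
    gf_powerset_filter_split hv (fun S => 2 ≤ #S ∧ S ∈ KX), gf_powerset_filter_split hv (fun S => 2 ≤ #S ∧ S ∈ KZ),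
    gf_powerset_filter_split hv (fun S => #S ≤ 1 ∧ S ∈ KX ∧ S ∈ KZ), gf_powerset_filter_split hv (fun S => #S = 1 ∧ S ∈ KX ∧ S ∈ KZ)]
  simp only [l1, l2, l3, l4, l5, l6, l7]
  ring

/-- `G(0,1,1)` is symmetric in the two complexes. [this work] -/
theorem G011V_comm (V : Finset α) : G011V V KX KZ = G011V V KZ KX := by
  have h1 : (V.powerset.filter fun S => #S ≤ 1 ∧ S ∈ KX ∧ S ∈ KZ) = V.powerset.filter fun S => #S ≤ 1 ∧ S ∈ KZ ∧ S ∈ KX :=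
    filter_congr fun S _ => by tauto
  have h2 : (V.powerset.filter fun S => #S = 1 ∧ S ∈ KX ∧ S ∈ KZ) = V.powerset.filter fun S => #S = 1 ∧ S ∈ KZ ∧ S ∈ KX :=
    filter_congr fun S _ => by tauto
  unfold G011V hYV eYV
  rw [h1, h2]
  ring

/-- Base of the induction: on the empty ground set `G(0,1,1) = 0`. [this work] -/
theorem G011V_empty (h0X : ∅ ∈ KX) (h0Z : ∅ ∈ KZ) : G011V (∅ : Finset α) KX KZ = 0 := by
  unfold G011V PiV Th1V D1V hV tV hYV eYV
  have gf1 : gf ({∅} : Finset (Finset α)) = 1 := by unfold gf; rw [sum_singleton]; unfold ind; rw [sum_empty]; rfl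
  have gf0 : gf (∅ : Finset (Finset α)) = 0 := by unfold gf; rw [sum_empty]
  simp only [powerset_empty, filter_singleton, card_empty, h0X, h0Z]
  norm_num [gf1, gf0]

end expansion

end Summit.CriticalPhenomena.PercolationContinuityZ3.Theorems.SahiCTCForms
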